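import Literature.Probability.LatticeModels.LevelTransport
import Literature.Probability.LatticeModels.OrientationReflect
import HarnessLib

/-!
# Transport lemmas for the coexistence case (GH2000, Lemma 5.5, Case 3): levels, shifts, sides

Topic `Probability/LatticeModels`. Book-keeping for the contour-free treatment of Case 3 of the
proof of Georgii–Higuchi 2000, Lemma 5.5 ("`μ(E⁺_up) = μ(E⁻_up) = 1`"): the good-crossing estimate
is proved at the level `L = m + 1` above the band `{|z₁| ≤ m, z₂ ≤ m}` (`LevelTransport.lean`,
orientation "`+`face on the left"); here we add

* `le_measureReal_upperGoodCrossing_of_level_right` — the same transport for the orientation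
  "`+`face on the right" (`le_measureReal_goodWalk_of_pinning_right`);
* `exists_infinite_cluster_configShift_iff_lattice/star` — `θ_u` moves the half-plane `{x₂ ≥ k}`
  to `{x₂ ≥ k - u₂}` in the events "an infinite `s`-cluster (`∗`-cluster) of the half-plane exists";
* `preimage_pinPlus_configShift`, `preimage_pinMinus_configShift` — pull-backs of the pinning
  events along `θ_u`;
* `setOf_exists_goodWalk_reverse` — reversing the good walk.

## References

* H.-O. Georgii, Y. Higuchi, *Percolation and number of phases in the two-dimensional Ising
  model*, J. Math. Phys. 41 (2000), Lemma 5.5 (proof, Case 3) [GeorgiiHiguchi2000].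
-/

noncomputable section

open MeasureTheory Filter SimpleGraph
open Literature.Probability.Percolation
open scoped ENNReal

namespace Literature.Probability.LatticeModels

/-! ### Shifting cluster events and pinning events -/

section Shift

/-- A translation moves the half-plane in the event "an infinite `s`-cluster of `{x₂ ≥ k}` exists"
(lattice clusters). [folklore] -/
theorem exists_infinite_cluster_configShift_iff_lattice (s : ℤˣ) (u : Site 2) (k : ℤ) (ω : SpinConfig (Site 2)) :
    (∃ y, (siteCluster (zdGraph 2) (spinSites s (configShift u ω) ∩ halfPlane k) y).Infinite) ↔
      ∃ y, (siteCluster (zdGraph 2) (spinSites s ω ∩ halfPlane (k - u 1)) y).Infinite := by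
  set φ := zdShiftIso (d := 2) u with hφ
  have hcfg : (configShift (S := ℤˣ) u ω : SpinConfig (Site 2)) = configRelabel φ.toEquiv ω := rfl
  have himg : (φ : Site 2 → Site 2) '' (spinSites s ω ∩ halfPlane (k - u 1)) =
      (φ : Site 2 → Site 2) '' spinSites s ω ∩ halfPlane k := by
    ext z
    simp only [Set.mem_image, Set.mem_inter_iff, halfPlane, Set.mem_setOf_eq, hφ, zdShiftIso_apply]
    constructor
    · rintro ⟨y, ⟨hy, hy1⟩, rfl⟩
      exact ⟨⟨y, hy, rfl⟩, by simp; omega⟩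
    · rintro ⟨⟨y, hy, rfl⟩, hz1⟩
      refine ⟨y, ⟨hy, ?_⟩, rfl⟩
      simp at hz1; omega
  have hO : spinSites s (configShift (S := ℤˣ) u ω) ∩ halfPlane k =
      (φ : Site 2 → Site 2) '' (spinSites s ω ∩ halfPlane (k - u 1)) := by
    rw [hcfg, spinSites_configRelabel, himg]; rfl
  have key : ∀ y : Site 2, siteCluster (zdGraph 2) ((φ : Site 2 → Site 2) '' (spinSites s ω ∩ halfPlane (k - u 1))) (φ y) =
      (φ : Site 2 → Site 2) '' siteCluster (zdGraph 2) (spinSites s ω ∩ halfPlane (k - u 1)) y := fun y => by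
    have h := siteCluster_relabel φ (spinSites s ω ∩ halfPlane (k - u 1)) y
    rwa [SiteConfig.relabel_apply] at h
  rw [hO]
  constructor
  · rintro ⟨y, hy⟩
    refine ⟨φ.symm y, ?_⟩
    have hk := key (φ.symm y)
    rw [RelIso.apply_symm_apply] at hk
    rw [hk] at hy
    exact Set.Infinite.of_image _ hy
  · rintro ⟨y, hy⟩
    exact ⟨φ y, by rw [key]; exact hy.image φ.injective.injOn⟩

/-- A translation moves the half-plane in the event "an infinite `s∗`-cluster of `{x₂ ≥ k}` exists"
(`∗`-clusters). [folklore] -/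
theorem exists_infinite_cluster_configShift_iff_star (s : ℤˣ) (u : Site 2) (k : ℤ) (ω : SpinConfig (Site 2)) :
    (∃ y, (siteCluster zdStarGraph (spinSites s (configShift u ω) ∩ halfPlane k) y).Infinite) ↔
      ∃ y, (siteCluster zdStarGraph (spinSites s ω ∩ halfPlane (k - u 1)) y).Infinite := by
  set φ := starShiftIso u with hφ
  have hcfg : (configShift (S := ℤˣ) u ω : SpinConfig (Site 2)) = configRelabel φ.toEquiv ω := rfl
  have himg : (φ : Site 2 → Site 2) '' (spinSites s ω ∩ halfPlane (k - u 1)) =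
      (φ : Site 2 → Site 2) '' spinSites s ω ∩ halfPlane k := by
    ext z
    simp only [Set.mem_image, Set.mem_inter_iff, halfPlane, Set.mem_setOf_eq, hφ, starShiftIso_apply]
    constructor
    · rintro ⟨y, ⟨hy, hy1⟩, rfl⟩
      exact ⟨⟨y, hy, rfl⟩, by simp; omega⟩
    · rintro ⟨⟨y, hy, rfl⟩, hz1⟩
      refine ⟨y, ⟨hy, ?_⟩, rfl⟩
      simp at hz1; omega
  have hO : spinSites s (configShift (S := ℤˣ) u ω) ∩ halfPlane k =
      (φ : Site 2 → Site 2) '' (spinSites s ω ∩ halfPlane (k - u 1)) := by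
    rw [hcfg, spinSites_configRelabel, himg]; rfl
  have key : ∀ y : Site 2, siteCluster zdStarGraph ((φ : Site 2 → Site 2) '' (spinSites s ω ∩ halfPlane (k - u 1))) (φ y) =
      (φ : Site 2 → Site 2) '' siteCluster zdStarGraph (spinSites s ω ∩ halfPlane (k - u 1)) y := fun y => by
    have h := siteCluster_relabel φ (spinSites s ω ∩ halfPlane (k - u 1)) y
    rwa [SiteConfig.relabel_apply] at h
  rw [hO]
  constructor
  · rintro ⟨y, hy⟩
    refine ⟨φ.symm y, ?_⟩
    have hk := key (φ.symm y)
    rw [RelIso.apply_symm_apply] at hk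
    rw [hk] at hy
    exact Set.Infinite.of_image _ hy
  · rintro ⟨y, hy⟩
    exact ⟨φ y, by rw [key]; exact hy.image φ.injective.injOn⟩

/-- The event "an infinite `s`-cluster of `{x₂ ≥ k}` exists" under the translate `μ ∘ θ_u⁻¹`. [folklore] -/
theorem ae_exists_infinite_cluster_map_configShift_iff_lattice {μ : Measure (SpinConfig (Site 2))}
    (s : ℤˣ) (u : Site 2) (k : ℤ) :
    (∀ᵐ ω ∂(μ.map (configShift u)), ∃ y, (siteCluster (zdGraph 2) (spinSites s ω ∩ halfPlane k) y).Infinite) ↔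
      ∀ᵐ ω ∂μ, ∃ y, (siteCluster (zdGraph 2) (spinSites s ω ∩ halfPlane (k - u 1)) y).Infinite := by
  classical
  have hmeas : MeasurableSet {ω : SpinConfig (Site 2) | ∃ y, (siteCluster (zdGraph 2) (spinSites s ω ∩ halfPlane k) y).Infinite} :=
    MeasurableSet.of_tailEvents (measurableSet_tailEvents_existsInfClusterIn (G := zdGraph 2) s (halfPlane k))
  rw [ae_map_iff (configShift _).measurable.aemeasurable hmeas]
  simp only [exists_infinite_cluster_configShift_iff_lattice]

/-- The event "an infinite `s∗`-cluster of `{x₂ ≥ k}` exists" under the translate `μ ∘ θ_u⁻¹`. [folklore] -/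
theorem ae_exists_infinite_cluster_map_configShift_iff_star {μ : Measure (SpinConfig (Site 2))}
    (s : ℤˣ) (u : Site 2) (k : ℤ) :
    (∀ᵐ ω ∂(μ.map (configShift u)), ∃ y, (siteCluster zdStarGraph (spinSites s ω ∩ halfPlane k) y).Infinite) ↔
      ∀ᵐ ω ∂μ, ∃ y, (siteCluster zdStarGraph (spinSites s ω ∩ halfPlane (k - u 1)) y).Infinite := by
  classical
  have hmeas : MeasurableSet {ω : SpinConfig (Site 2) | ∃ y, (siteCluster zdStarGraph (spinSites s ω ∩ halfPlane k) y).Infinite} :=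
    MeasurableSet.of_tailEvents (measurableSet_tailEvents_existsInfClusterIn (G := zdStarGraph) s (halfPlane k))
  rw [ae_map_iff (configShift _).measurable.aemeasurable hmeas]
  simp only [exists_infinite_cluster_configShift_iff_star]

/-- An infinite lattice cluster is contained in an infinite `∗`-cluster. [folklore] -/
theorem infinite_starCluster_of_latticeCluster {O : Set (Site 2)} {x : Site 2}
    (h : (siteCluster (zdGraph 2) O x).Infinite) : (siteCluster zdStarGraph O x).Infinite := by
  refine h.mono fun y hy => ⟨hy.1, hy.2.1, hy.2.2.mono ?_⟩
  intro a b hab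
  rw [siteOpenGraph_adj] at hab ⊢
  exact ⟨zdGraph_le_zdStarGraph hab.1, hab.2.1, hab.2.2⟩

/-- **Pull-back of the `+` pinning event along a translation of the configuration.** [folklore] -/
theorem preimage_pinPlus_configShift (u x : Site 2) (k : ℤ) (Q : Site 2 → Prop) :
    (configShift (S := ℤˣ) u) ⁻¹' {ω : SpinConfig (Site 2) | ∃ z, (siteCluster zdStarGraph (spinSites 1 ω ∩ halfPlane k) z).Infinite ∧
        ∃ w : zdStarGraph.Walk x z, ∀ v ∈ w.support, ω v = 1 ∧ Q v} =
      {ω | ∃ z, (siteCluster zdStarGraph (spinSites 1 ω ∩ halfPlane (k - u 1)) z).Infinite ∧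
        ∃ w : zdStarGraph.Walk (x - u) z, ∀ v ∈ w.support, ω v = 1 ∧ Q (v + u)} := by
  set φ := starShiftIso u with hφ
  have hO : ∀ ω : SpinConfig (Site 2), spinSites 1 (configShift (S := ℤˣ) u ω) ∩ halfPlane k =
      (φ : Site 2 → Site 2) '' (spinSites 1 ω ∩ halfPlane (k - u 1)) := by
    intro ω
    have hcfg : (configShift (S := ℤˣ) u ω : SpinConfig (Site 2)) = configRelabel φ.toEquiv ω := rfl
    rw [hcfg, spinSites_configRelabel]
    ext z
    simp only [Set.mem_image, Set.mem_inter_iff, halfPlane, Set.mem_setOf_eq, hφ, starShiftIso_apply]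
    constructor
    · rintro ⟨⟨y, hy, rfl⟩, hz1⟩
      refine ⟨y, ⟨hy, ?_⟩, rfl⟩
      simp at hz1; omega
    · rintro ⟨y, ⟨hy, hy1⟩, rfl⟩
      exact ⟨⟨y, hy, rfl⟩, by simp; omega⟩
  have key : ∀ (ω : SpinConfig (Site 2)) (y : Site 2),
      siteCluster zdStarGraph ((φ : Site 2 → Site 2) '' (spinSites 1 ω ∩ halfPlane (k - u 1))) (φ y) =
        (φ : Site 2 → Site 2) '' siteCluster zdStarGraph (spinSites 1 ω ∩ halfPlane (k - u 1)) y := fun ω y => by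
    have h := siteCluster_relabel φ (spinSites 1 ω ∩ halfPlane (k - u 1)) y
    rwa [SiteConfig.relabel_apply] at h
  ext ω
  simp only [Set.mem_preimage, Set.mem_setOf_eq]
  constructor
  · rintro ⟨z, hz, w, hw⟩
    refine ⟨z - u, ?_, ?_⟩
    · have hk := key ω (z - u)
      have hzu : φ (z - u) = z := by simp [hφ]
      rw [hzu, ← hO ω] at hk
      rw [hk] at hz
      exact Set.Infinite.of_image _ hz
    · obtain ⟨w', hw'⟩ := exists_starWalk_shift (-u) ⟨w, hw⟩
      refine ⟨w'.copy (sub_eq_add_neg x u).symm (sub_eq_add_neg z u).symm, fun v hv => ?_⟩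
      rw [Walk.support_copy] at hv
      have := hw' v hv
      simp only [sub_neg_eq_add, configShift_apply, add_sub_cancel_right] at this
      exact this
  · rintro ⟨z, hz, w, hw⟩
    refine ⟨z + u, ?_, ?_⟩
    · have hk := key ω z
      have hzu : φ z = z + u := by simp [hφ]
      rw [hzu, ← hO ω] at hk
      rw [hk]
      exact hz.image φ.injective.injOn
    · obtain ⟨w', hw'⟩ := exists_starWalk_shift u ⟨w, hw⟩
      refine ⟨w'.copy (sub_add_cancel x u) rfl, fun v hv => ?_⟩
      rw [Walk.support_copy] at hv
      have := hw' v hv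
      simp only [configShift_apply]
      rwa [sub_add_cancel] at this

/-- **Pull-back of the `-` pinning event along a translation of the configuration.** [folklore] -/
theorem preimage_pinMinus_configShift (u x : Site 2) (k : ℤ) (Q : Site 2 → Prop) :
    (configShift (S := ℤˣ) u) ⁻¹' {ω : SpinConfig (Site 2) | ∃ z, (siteCluster (zdGraph 2) (spinSites (-1) ω ∩ halfPlane k) z).Infinite ∧
        ∃ w : zdStarGraph.Walk x z, ∀ v ∈ w.support, ω v = -1 ∧ Q v} =
      {ω | ∃ z, (siteCluster (zdGraph 2) (spinSites (-1) ω ∩ halfPlane (k - u 1)) z).Infinite ∧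
        ∃ w : zdStarGraph.Walk (x - u) z, ∀ v ∈ w.support, ω v = -1 ∧ Q (v + u)} := by
  set φ := zdShiftIso (d := 2) u with hφ
  have hO : ∀ ω : SpinConfig (Site 2), spinSites (-1) (configShift (S := ℤˣ) u ω) ∩ halfPlane k =
      (φ : Site 2 → Site 2) '' (spinSites (-1) ω ∩ halfPlane (k - u 1)) := by
    intro ω
    have hcfg : (configShift (S := ℤˣ) u ω : SpinConfig (Site 2)) = configRelabel φ.toEquiv ω := rfl
    rw [hcfg, spinSites_configRelabel]
    ext z
    simp only [Set.mem_image, Set.mem_inter_iff, halfPlane, Set.mem_setOf_eq, hφ, zdShiftIso_apply]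
    constructor
    · rintro ⟨⟨y, hy, rfl⟩, hz1⟩
      refine ⟨y, ⟨hy, ?_⟩, rfl⟩
      simp at hz1; omega
    · rintro ⟨y, ⟨hy, hy1⟩, rfl⟩
      exact ⟨⟨y, hy, rfl⟩, by simp; omega⟩
  have key : ∀ (ω : SpinConfig (Site 2)) (y : Site 2),
      siteCluster (zdGraph 2) ((φ : Site 2 → Site 2) '' (spinSites (-1) ω ∩ halfPlane (k - u 1))) (φ y) =
        (φ : Site 2 → Site 2) '' siteCluster (zdGraph 2) (spinSites (-1) ω ∩ halfPlane (k - u 1)) y := fun ω y => by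
    have h := siteCluster_relabel φ (spinSites (-1) ω ∩ halfPlane (k - u 1)) y
    rwa [SiteConfig.relabel_apply] at h
  ext ω
  simp only [Set.mem_preimage, Set.mem_setOf_eq]
  constructor
  · rintro ⟨z, hz, w, hw⟩
    refine ⟨z - u, ?_, ?_⟩
    · have hk := key ω (z - u)
      have hzu : φ (z - u) = z := by simp [hφ]
      rw [hzu, ← hO ω] at hk
      rw [hk] at hz
      exact Set.Infinite.of_image _ hz
    · obtain ⟨w', hw'⟩ := exists_starWalk_shift (-u) ⟨w, hw⟩
      refine ⟨w'.copy (sub_eq_add_neg x u).symm (sub_eq_add_neg z u).symm, fun v hv => ?_⟩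
      rw [Walk.support_copy] at hv
      have := hw' v hv
      simp only [sub_neg_eq_add, configShift_apply, add_sub_cancel_right] at this
      exact this
  · rintro ⟨z, hz, w, hw⟩
    refine ⟨z + u, ?_, ?_⟩
    · have hk := key ω z
      have hzu : φ z = z + u := by simp [hφ]
      rw [hzu, ← hO ω] at hk
      rw [hk]
      exact hz.image φ.injective.injOn
    · obtain ⟨w', hw'⟩ := exists_starWalk_shift u ⟨w, hw⟩
      refine ⟨w'.copy (sub_add_cancel x u) rfl, fun v hv => ?_⟩
      rw [Walk.support_copy] at hv
      have := hw' v hv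
      simp only [configShift_apply]
      rwa [sub_add_cancel] at this

/-- Reversing the good walk. [folklore] -/
theorem setOf_exists_goodWalk_reverse (x y : Site 2) (Q : Site 2 → Prop) :
    {p : SpinConfig (Site 2) × SpinConfig (Site 2) | ∃ w : zdStarGraph.Walk x y, ∀ z ∈ w.support, p.1 z ≤ p.2 z ∧ Q z} =
      {p | ∃ w : zdStarGraph.Walk y x, ∀ z ∈ w.support, p.1 z ≤ p.2 z ∧ Q z} := by
  ext p
  constructor
  · rintro ⟨w, hw⟩
    exact ⟨w.reverse, fun z hz => hw z (by rw [Walk.support_reverse, List.mem_reverse] at hz; exact hz)⟩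
  · rintro ⟨w, hw⟩
    exact ⟨w.reverse, fun z hz => hw z (by rw [Walk.support_reverse, List.mem_reverse] at hz; exact hz)⟩

end Shift

/-! ### The level transport for the orientation "`+`face on the right" -/

section LevelRight

variable {β : ℝ} {μ : Measure (SpinConfig (Site 2))}

/-- **The good-crossing estimate at the axis from the estimate at level `L`, orientation "right"**:
as `le_measureReal_upperGoodCrossing_of_level`, with the infinite `+∗`cluster of `μ_L` touching the
axis unboundedly to the right, `x = (-a, -L)` pinned to the infinite `-`cluster in the layer `ω` and
`y = (b, -L)` pinned to the infinite `+∗`cluster in the layer `ω̂`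
(`le_measureReal_goodWalk_of_pinning_right`). [cite: GeorgiiHiguchi2000, Lemma 5.5 (proof, Case 3, p. 15)] -/
theorem le_measureReal_upperGoodCrossing_of_level_right (hβc : criticalBeta 2 < β) (hμ : μ ∈ isingGibbsMeasures 2 β 0)
    (hμt : IsTailTrivial μ) (s : ℤˣ) (m : ℕ) (a b : ℤ) {cP : ℝ} (hcP : 0 ≤ cP)
    (hR : ∀ᵐ ω ∂(μ.map (configShift (-((m + 1 : ℕ) : ℤ) • (Pi.single 1 1 : Site 2)))),
      ∃ x, ∀ n : ℕ, ∃ k : ℤ, (n : ℤ) < k ∧ (![k, 0] : Site 2) ∈ siteCluster zdStarGraph (spinSites 1 ω ∩ halfPlane 0) x)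
    (hC : ∀ᵐ ω ∂(μ.map (configShift (-((m + 1 : ℕ) : ℤ) • (Pi.single 1 1 : Site 2)))),
      ∃ y, (siteCluster (zdGraph 2) (spinSites (-1) ω ∩ halfPlane 0) y).Infinite)
    (hpinx : cP ≤ (μ.map (configShift (-((m + 1 : ℕ) : ℤ) • (Pi.single 1 1 : Site 2)))).real
      {ω : SpinConfig (Site 2) | ∃ z, (siteCluster (zdGraph 2) (spinSites (-1) ω ∩ halfPlane 0) z).Infinite ∧
        ∃ w : zdStarGraph.Walk (![-a, -((m + 1 : ℕ) : ℤ)]) z, ∀ v ∈ w.support,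
          ω v = -1 ∧ ¬ (-(m : ℤ) ≤ v 0 ∧ v 0 ≤ m ∧ v 1 ≤ -1)})
    (hpiny : cP ≤ ((μ.map (configShift (-((m + 1 : ℕ) : ℤ) • (Pi.single 1 1 : Site 2)))).map
        (configShift (Pi.single 0 (s : ℤ)))).real
      {ω : SpinConfig (Site 2) | ∃ z, (siteCluster zdStarGraph (spinSites 1 ω ∩ halfPlane 0) z).Infinite ∧
        ∃ w : zdStarGraph.Walk (![b, -((m + 1 : ℕ) : ℤ)]) z, ∀ v ∈ w.support,
          ω v = 1 ∧ ¬ (-(m : ℤ) ≤ v 0 ∧ v 0 ≤ m ∧ v 1 ≤ -1)}) :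
    ((1 - (1 + ENNReal.ofReal (Real.exp (-(8 * |β|)) / 2))⁻¹) / 2).toReal * cP * cP ≤
      (μ.prod (μ.map (configShift (Pi.single 0 (s : ℤ))))).real
        {p : SpinConfig (Site 2) × SpinConfig (Site 2) | ∃ w : zdStarGraph.Walk (![-a, 0]) (![b, 0]),
          ∀ z ∈ w.support, p.1 z ≤ p.2 z ∧ ¬ (-(m : ℤ) ≤ z 0 ∧ z 0 ≤ m ∧ z 1 ≤ m)} := by
  have hμG : IsGibbsMeasure (isingSpecification (zdGraph 2) β 0) μ := hμ
  haveI := hμG.isProbabilityMeasure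
  set L : ℕ := m + 1 with hLdef
  set vL : Site 2 := -((L : ℕ) : ℤ) • (Pi.single 1 1 : Site 2) with hvL
  set T : SpinConfig (Site 2) → SpinConfig (Site 2) := ⇑(configShift (S := ℤˣ) vL) with hT
  have hTm : Measurable T := (configShift _).measurable
  set μL : Measure (SpinConfig (Site 2)) := μ.map T with hμL
  have hμLG : μL ∈ isingGibbsMeasures 2 β 0 := mem_isingGibbsMeasures_map_configShift hμ _
  have hμLt : IsTailTrivial μL := hμt.map_configRelabel (Site.shift _)
  have hQ : ∀ v : Site 2, 0 ≤ v 1 → ¬ (-(m : ℤ) ≤ v 0 ∧ v 0 ≤ m ∧ v 1 ≤ -1) := fun v hv h => by omega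
  have hQR : ∀ v : Site 2, (¬ (-(m : ℤ) ≤ (reflectCoord 0 v) 0 ∧ (reflectCoord 0 v) 0 ≤ m ∧ (reflectCoord 0 v) 1 ≤ -1)) ↔
      ¬ (-(m : ℤ) ≤ v 0 ∧ v 0 ≤ m ∧ v 1 ≤ -1) := fun v => by
    rw [reflectCoord_apply, reflectCoord_apply]
    simp; omega
  have key := le_measureReal_goodWalk_of_pinning_right hβc hμLG hμLt s hR hC hQ hQR
    (![-a, -((m + 1 : ℕ) : ℤ)]) (![b, -((m + 1 : ℕ) : ℤ)]) hpinx hpiny hcP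
  -- pull back along `T × T`
  have hprod := prod_map_configShift_comm μ (Pi.single (0 : Fin 2) (s : ℤ)) vL
  have hset : MeasurableSet {p : SpinConfig (Site 2) × SpinConfig (Site 2) |
      ∃ w : zdStarGraph.Walk (![-a, -((m + 1 : ℕ) : ℤ)]) (![b, -((m + 1 : ℕ) : ℤ)]),
        ∀ z ∈ w.support, p.1 z ≤ p.2 z ∧ ¬ (-(m : ℤ) ≤ z 0 ∧ z 0 ≤ m ∧ z 1 ≤ -1)} := measurableSet_goodCrossing _ _ _
  rw [measureReal_def, hprod, Measure.map_apply (hTm.prodMap hTm) hset, preimage_goodWalk_configShift] at key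
  have hx : (![-a, -((m + 1 : ℕ) : ℤ)] : Site 2) - vL = ![-a, 0] := by
    rw [hvL]; ext i; fin_cases i <;> simp [hLdef]
  have hy : (![b, -((m + 1 : ℕ) : ℤ)] : Site 2) - vL = ![b, 0] := by
    rw [hvL]; ext i; fin_cases i <;> simp [hLdef]
  have hQ' : ∀ z : Site 2, (¬ (-(m : ℤ) ≤ (z + vL) 0 ∧ (z + vL) 0 ≤ m ∧ (z + vL) 1 ≤ -1)) ↔
      ¬ (-(m : ℤ) ≤ z 0 ∧ z 0 ≤ m ∧ z 1 ≤ m) := fun z => by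
    rw [hvL]; simp [hLdef]; omega
  rw [measureReal_def]
  convert key using 3
  ext p
  simp only [Set.mem_setOf_eq]
  rw [hx, hy]
  constructor
  · rintro ⟨w, hw⟩; exact ⟨w, fun z hz => ⟨(hw z hz).1, (hQ' z).2 (hw z hz).2⟩⟩
  · rintro ⟨w, hw⟩; exact ⟨w, fun z hz => ⟨(hw z hz).1, (hQ' z).1 (hw z hz).2⟩⟩

end LevelRight

/-! ### Sides: orientation of the `+∗`cluster under horizontal shifts, and of the `-`cluster -/

section Sides

variable {β : ℝ} {μ : Measure (SpinConfig (Site 2))} {ω : SpinConfig (Site 2)}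

/-- Axis sites of the `+∗`clusters of a horizontally shifted configuration. [folklore] -/
theorem mem_plusStarCluster_configShift_iff (t : ℤ) (ω : SpinConfig (Site 2)) (x : Site 2) (k : ℤ) :
    (![k, 0] : Site 2) ∈ siteCluster zdStarGraph (spinSites 1 (configShift (Pi.single 0 t) ω) ∩ halfPlane 0) (x + Pi.single 0 t) ↔
      (![k - t, 0] : Site 2) ∈ siteCluster zdStarGraph (spinSites 1 ω ∩ halfPlane 0) x := by
  set φ := starShiftIso (Pi.single 0 t) with hφ
  have hcfg : (configShift (S := ℤˣ) (Pi.single 0 t) ω : SpinConfig (Site 2)) = configRelabel φ.toEquiv ω := rfl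
  have hO : spinSites 1 (configShift (S := ℤˣ) (Pi.single 0 t) ω) ∩ halfPlane 0 =
      (φ : Site 2 → Site 2) '' (spinSites 1 ω ∩ halfPlane 0) := by
    rw [hcfg, spinSites_configRelabel]
    ext z
    simp only [Set.mem_image, Set.mem_inter_iff, halfPlane, Set.mem_setOf_eq, hφ, starShiftIso_apply]
    constructor
    · rintro ⟨⟨y, hy, rfl⟩, hz1⟩
      refine ⟨y, ⟨hy, ?_⟩, rfl⟩
      simpa using hz1
    · rintro ⟨y, ⟨hy, hy1⟩, rfl⟩
      exact ⟨⟨y, hy, rfl⟩, by simpa using hy1⟩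
  have key : siteCluster zdStarGraph ((φ : Site 2 → Site 2) '' (spinSites 1 ω ∩ halfPlane 0)) (φ x) =
      (φ : Site 2 → Site 2) '' siteCluster zdStarGraph (spinSites 1 ω ∩ halfPlane 0) x := by
    have h := siteCluster_relabel φ (spinSites 1 ω ∩ halfPlane 0) x
    rwa [SiteConfig.relabel_apply] at h
  have hx : (φ x : Site 2) = x + Pi.single 0 t := rfl
  rw [hO, ← hx, key]
  constructor
  · rintro ⟨y, hy, hyk⟩
    have : y = ![k - t, 0] := by
      have h0 := congrFun hyk 0
      have h1 := congrFun hyk 1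
      simp [hφ] at h0 h1
      rw [Site.eq_iff_two]; constructor <;> simp <;> omega
    rwa [← this]
  · intro h
    exact ⟨_, h, by rw [Site.eq_iff_two]; simp [hφ]⟩

/-- The event "some `+∗`cluster of `π_up` has axis sites unbounded below" is invariant under
horizontal shifts of the configuration. [folklore] -/
theorem exists_plusStar_axisUnboundedBelow_configShift_iff (t : ℤ) (ω : SpinConfig (Site 2)) :
    (∃ x, ∀ n : ℕ, ∃ k : ℤ, k < -(n : ℤ) ∧ (![k, 0] : Site 2) ∈
        siteCluster zdStarGraph (spinSites 1 (configShift (Pi.single 0 t) ω) ∩ halfPlane 0) x) ↔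
      ∃ x, ∀ n : ℕ, ∃ k : ℤ, k < -(n : ℤ) ∧ (![k, 0] : Site 2) ∈ siteCluster zdStarGraph (spinSites 1 ω ∩ halfPlane 0) x := by
  constructor
  · rintro ⟨x, hx⟩
    refine ⟨x - Pi.single 0 t, fun n => ?_⟩
    obtain ⟨k, hk, hmem⟩ := hx (n + t.natAbs)
    refine ⟨k - t, ?_, ?_⟩
    · push_cast at hk; rcases abs_cases t with ⟨h1, h2⟩ | ⟨h1, h2⟩ <;> omega
    · rw [← mem_plusStarCluster_configShift_iff, sub_add_cancel]; exact hmem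
  · rintro ⟨x, hx⟩
    refine ⟨x + Pi.single 0 t, fun n => ?_⟩
    obtain ⟨k, hk, hmem⟩ := hx (n + t.natAbs)
    refine ⟨k + t, ?_, ?_⟩
    · push_cast at hk; rcases abs_cases t with ⟨h1, h2⟩ | ⟨h1, h2⟩ <;> omega
    · rw [mem_plusStarCluster_configShift_iff, add_sub_cancel_right]; exact hmem

/-- The event "some `+∗`cluster of `π_up` has axis sites unbounded above" is invariant under
horizontal shifts of the configuration. [folklore] -/
theorem exists_plusStar_axisUnboundedAbove_configShift_iff (t : ℤ) (ω : SpinConfig (Site 2)) :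
    (∃ x, ∀ n : ℕ, ∃ k : ℤ, (n : ℤ) < k ∧ (![k, 0] : Site 2) ∈
        siteCluster zdStarGraph (spinSites 1 (configShift (Pi.single 0 t) ω) ∩ halfPlane 0) x) ↔
      ∃ x, ∀ n : ℕ, ∃ k : ℤ, (n : ℤ) < k ∧ (![k, 0] : Site 2) ∈ siteCluster zdStarGraph (spinSites 1 ω ∩ halfPlane 0) x := by
  constructor
  · rintro ⟨x, hx⟩
    refine ⟨x - Pi.single 0 t, fun n => ?_⟩
    obtain ⟨k, hk, hmem⟩ := hx (n + t.natAbs)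
    refine ⟨k - t, ?_, ?_⟩
    · push_cast at hk; rcases abs_cases t with ⟨h1, h2⟩ | ⟨h1, h2⟩ <;> omega
    · rw [← mem_plusStarCluster_configShift_iff, sub_add_cancel]; exact hmem
  · rintro ⟨x, hx⟩
    refine ⟨x + Pi.single 0 t, fun n => ?_⟩
    obtain ⟨k, hk, hmem⟩ := hx (n + t.natAbs)
    refine ⟨k + t, ?_, ?_⟩
    · push_cast at hk; rcases abs_cases t with ⟨h1, h2⟩ | ⟨h1, h2⟩ <;> omega
    · rw [mem_plusStarCluster_configShift_iff, add_sub_cancel_right]; exact hmem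

/-- **Sides, almost surely: `+∗` on the left forces `-` on the right.** If almost surely some
`+∗`cluster of `π_up` has axis sites unbounded below and an infinite `-`cluster of `π_up` exists, then
almost surely some infinite `-`cluster of `π_up` has axis sites unbounded above (Georgii–Higuchi 2000,
§5: "`I^{+∗}_up` meets `ℓ_left` infinitely often, and `I⁻_up` meets `ℓ_right` infinitely often"). [cite: GeorgiiHiguchi2000, Lemma 5.3 (proof, p. 13)] -/
theorem ae_minus_axisUnboundedAbove_of_plusStar_below (hβc : criticalBeta 2 < β) (hμ : μ ∈ isingGibbsMeasures 2 β 0)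
    (hL : ∀ᵐ ω ∂μ, ∃ x, ∀ n : ℕ, ∃ k : ℤ, k < -(n : ℤ) ∧
      (![k, 0] : Site 2) ∈ siteCluster zdStarGraph (spinSites 1 ω ∩ halfPlane 0) x)
    (hM : ∀ᵐ ω ∂μ, ∃ y, (siteCluster (zdGraph 2) (spinSites (-1) ω ∩ halfPlane 0) y).Infinite) :
    ∀ᵐ ω ∂μ, ∃ y, ∀ n : ℕ, ∃ k : ℤ, (n : ℤ) < k ∧
      (![k, 0] : Site 2) ∈ siteCluster (zdGraph 2) (spinSites (-1) ω ∩ halfPlane 0) y := by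
  filter_upwards [ae_plusStar_minus_sides hβc hμ,
    ae_minus_touches_axis_io (G := zdGraph 2) hβc le_rfl zdGraph_le_zdStarGraph hμ, hL, hM] with ω hsides hCt ⟨x, hx⟩ ⟨y, hy⟩
  have hDinf := infinite_of_axis_unbounded_below hx
  obtain ⟨z₀, hz₀, hz₀1, -⟩ := hCt y hy 0
  have hk₀ : (![z₀ 0, 0] : Site 2) ∈ siteCluster (zdGraph 2) (spinSites (-1) ω ∩ halfPlane 0) y := by
    rw [← eq_axis_of_apply_one hz₀1]; exact hz₀
  rcases hsides x y hDinf hy with hlt | hgt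
  · refine ⟨y, fun n => ?_⟩
    obtain ⟨a₀, -, ha₀⟩ := hx 0
    obtain ⟨z, hz, hz1, hzn⟩ := hCt y hy (n + a₀.natAbs)
    have hzk : (![z 0, 0] : Site 2) ∈ siteCluster (zdGraph 2) (spinSites (-1) ω ∩ halfPlane 0) y := by
      rw [← eq_axis_of_apply_one hz1]; exact hz
    have hak : a₀ < z 0 := hlt a₀ (z 0) ha₀ hzk
    refine ⟨z 0, ?_, hzk⟩
    push_cast at hzn
    rcases abs_cases (z 0) with ⟨h1, h2⟩ | ⟨h1, h2⟩ <;> rcases abs_cases a₀ with ⟨h3, h4⟩ | ⟨h3, h4⟩ <;> omega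
  · exfalso
    obtain ⟨a, ha, hmem⟩ := hx (z₀ 0).natAbs
    have := hgt a (z₀ 0) hmem hk₀
    rcases abs_cases (z₀ 0) with ⟨h1, h2⟩ | ⟨h1, h2⟩ <;> push_cast at ha <;> omega

/-- **Sides, almost surely: `+∗` on the right forces `-` on the left.** [cite: GeorgiiHiguchi2000, Lemma 5.3 (proof, p. 13)] -/
theorem ae_minus_axisUnboundedBelow_of_plusStar_above (hβc : criticalBeta 2 < β) (hμ : μ ∈ isingGibbsMeasures 2 β 0)
    (hR : ∀ᵐ ω ∂μ, ∃ x, ∀ n : ℕ, ∃ k : ℤ, (n : ℤ) < k ∧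
      (![k, 0] : Site 2) ∈ siteCluster zdStarGraph (spinSites 1 ω ∩ halfPlane 0) x)
    (hM : ∀ᵐ ω ∂μ, ∃ y, (siteCluster (zdGraph 2) (spinSites (-1) ω ∩ halfPlane 0) y).Infinite) :
    ∀ᵐ ω ∂μ, ∃ y, ∀ n : ℕ, ∃ k : ℤ, k < -(n : ℤ) ∧
      (![k, 0] : Site 2) ∈ siteCluster (zdGraph 2) (spinSites (-1) ω ∩ halfPlane 0) y := by
  filter_upwards [ae_plusStar_minus_sides hβc hμ,
    ae_minus_touches_axis_io (G := zdGraph 2) hβc le_rfl zdGraph_le_zdStarGraph hμ, hR, hM] with ω hsides hCt ⟨x, hx⟩ ⟨y, hy⟩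
  have hDinf := infinite_of_axis_unbounded_above hx
  obtain ⟨z₀, hz₀, hz₀1, -⟩ := hCt y hy 0
  have hk₀ : (![z₀ 0, 0] : Site 2) ∈ siteCluster (zdGraph 2) (spinSites (-1) ω ∩ halfPlane 0) y := by
    rw [← eq_axis_of_apply_one hz₀1]; exact hz₀
  rcases hsides x y hDinf hy with hlt | hgt
  · exfalso
    obtain ⟨a, ha, hmem⟩ := hx (z₀ 0).natAbs
    have := hlt a (z₀ 0) hmem hk₀
    rcases abs_cases (z₀ 0) with ⟨h1, h2⟩ | ⟨h1, h2⟩ <;> push_cast at ha <;> omega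
  · refine ⟨y, fun n => ?_⟩
    obtain ⟨a₀, -, ha₀⟩ := hx 0
    obtain ⟨z, hz, hz1, hzn⟩ := hCt y hy (n + a₀.natAbs)
    have hzk : (![z 0, 0] : Site 2) ∈ siteCluster (zdGraph 2) (spinSites (-1) ω ∩ halfPlane 0) y := by
      rw [← eq_axis_of_apply_one hz1]; exact hz
    have hak : z 0 < a₀ := hgt a₀ (z 0) ha₀ hzk
    refine ⟨z 0, ?_, hzk⟩
    push_cast at hzn
    rcases abs_cases (z 0) with ⟨h1, h2⟩ | ⟨h1, h2⟩ <;> rcases abs_cases a₀ with ⟨h3, h4⟩ | ⟨h3, h4⟩ <;> omega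

end Sides

end Literature.Probability.LatticeModels
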